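import Literature.Computability.QuantumComplexity.ReversibleCliffordT
import Literature.Computability.Cryptography.QubitRegisterHGateProofs
import Literature.Computability.Cryptography.QubitRegisterTGateProofs
import Mathlib.Analysis.SpecialFunctions.Complex.Arg
import Mathlib.Analysis.Complex.Polynomial.Basic
import HarnessLib

/-!
# One-qubit unitaries: entrywise calculus and the `Z`–`X`–`Z` Euler decomposition

Topic `Literature/Computability/QuantumComplexity`, grouping namespace `OneQubit` (the one-qubit
unitary group `U(2) = U(QReg 1)`). Infrastructure for the universality proofs of Boykin et al.
(1999, §3: density of `⟨H, T⟩` in `U(2)` modulo phase) and Barenco et al. (1995: one-qubit gates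
and `CNOT` generate `U(2^n)`):

* `m2 a b c d` — the one-qubit matrix with rows `(a, b)`, `(c, d)` on `QReg 1 = (Fin 1 → Bool)`,
  its products, sums, adjoint, injectivity (`m2_mul_m2`, `conjTranspose_m2`, `m2_inj`, `eq_m2`),
  and the library gates in this form (`hGate_eq_m2`, `tGate_eq_m2`);
* `rz u = diag(u, ū)` — for `u = e^{-iθ/2}` this is the rotation `R_z(θ)`; `rz` is
  multiplicative (`rz_mul_rz`) and unitary for `‖u‖ = 1`; `hGate * rz u * hGate` is the
  corresponding `x`-rotation (`hGate_mul_rz_mul_hGate`);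
* **`exists_euler`** — the `Z`–`X`–`Z` Euler decomposition: every `V ∈ U(2)` is
  `c • (rz u₁ * (H * rz u₂ * H) * rz u₃)` with unit scalars `c, u₁, u₂, u₃` (Nielsen–Chuang 2010,
  Thm. 4.1 / eq. (4.11)–(4.12) is the `Z`–`Y` version; the `Z`–`X` version is the same statement
  for the orthogonal pair of axes `ẑ, x̂`, cf. Exercise 4.10 and Boykin et al. eq. (euler));
* **`subgroup_eq_top_of_conj_rz_mem`** — consequently a subgroup of `U(2)` containing the phases
  and, for some fixed `W ∈ U(2)`, the conjugates `W (rz u) W⁻¹` and `W (H rz u H) W⁻¹` of both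
  one-parameter families, is all of `U(2)`.

## References

* M. A. Nielsen, I. L. Chuang, *Quantum Computation and Quantum Information*, CUP 2010, §4.2,
  Thm. 4.1 (Z–Y decomposition), Ex. 4.10 (X–Y), eq. (4.4)–(4.6) (rotation operators)
  [NielsenChuang2010].
* P. O. Boykin, T. Mor, M. Pulver, V. Roychowdhury, F. Vatan, FOCS 1999, §2 eq. (euler0)–(3),
  §3 eq. (euler) (Euler decomposition about two orthogonal axes) [BoykinEtAl1999].

## Design notes

* Everything is phrased with unit complex numbers instead of angles (`rz u`, `u ū = 1`), which
  keeps the algebra polynomial; square roots of unit complex numbers come from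
  `IsAlgClosed.exists_pow_nat_eq`.
* All declarations live in the sub-namespace `…QuantumComplexity.OneQubit` to keep the flat
  topic namespace free (several sibling files have their own private `2 × 2` calculus, e.g.
  `mk2` of `ControlledHadamard.lean`, which imports the Forrelation development).
-/

noncomputable section

namespace Literature.Computability.QuantumComplexity.OneQubit

open Cryptography Matrix Complex

/-! ### The two basis labels of `QReg 1` and sums over `QReg 1` -/

/-- The label `|0⟩` of a one-qubit register. [folklore] -/
abbrev q0 : QReg 1 := fun _ => false

/-- The label `|1⟩` of a one-qubit register. [folklore] -/
abbrev q1 : QReg 1 := fun _ => true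

/-- A one-qubit label is determined by its bit. (Same statement as `qreg_one_eq` of
`SandwichApprox.lean` and `qReg_one_eq_iff` of `ControlledHadamard.lean`; both files import
large unrelated developments, so the two-line proof is repeated here.) [folklore] -/
theorem eq_of_apply_zero (x : QReg 1) : x = fun _ => x 0 := by
  funext i; rw [Subsingleton.elim i 0]

/-- `x = q1 ↔ x 0 = true`. [folklore] -/
theorem eq_q1_iff (x : QReg 1) : x = q1 ↔ x 0 = true :=
  ⟨fun h => by rw [h], fun h => by rw [eq_of_apply_zero x, h]⟩

/-- `x = q0 ↔ x 0 = false`. [folklore] -/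
theorem eq_q0_iff (x : QReg 1) : x = q0 ↔ x 0 = false :=
  ⟨fun h => by rw [h], fun h => by rw [eq_of_apply_zero x, h]⟩

/-- `q0 ≠ q1`. [folklore] -/
theorem q0_ne_q1 : q0 ≠ q1 := fun h => Bool.false_ne_true (congrFun h 0)

/-- Every one-qubit label is `q0` or `q1`. [folklore] -/
theorem eq_q0_or_eq_q1 (x : QReg 1) : x = q0 ∨ x = q1 := by
  rcases Bool.eq_false_or_eq_true (x 0) with h | h
  · exact Or.inr ((eq_q1_iff x).2 h)
  · exact Or.inl ((eq_q0_iff x).2 h)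

/-- A sum over the one-qubit labels is the sum over the two labels `q0`, `q1`. [folklore] -/
theorem sum_qReg_one {M : Type*} [AddCommMonoid M] (f : QReg 1 → M) : ∑ x, f x = f q0 + f q1 := by
  rw [Fintype.sum_equiv (Equiv.funUnique (Fin 1) Bool) f (fun b => f (fun _ => b))
    (fun x => congrArg f (funext fun i => congrArg x (Subsingleton.elim i _))), Fintype.sum_bool,
    add_comm]

/-! ### One-qubit matrices by entries -/

/-- The one-qubit matrix with rows `(a, b)` (row `|0⟩`) and `(c, d)` (row `|1⟩`), columns
`|0⟩, |1⟩`. [folklore] -/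
def m2 (a b c d : ℂ) : Matrix (QReg 1) (QReg 1) ℂ :=
  Matrix.of fun x y => if x 0 then (if y 0 then d else c) else (if y 0 then b else a)

/-- Entries of `m2`. [folklore] -/
theorem m2_apply (a b c d : ℂ) (x y : QReg 1) :
    m2 a b c d x y = if x 0 then (if y 0 then d else c) else (if y 0 then b else a) := rfl

/-- Entry `⟨0|·|0⟩` of `m2`. [folklore] -/
@[simp] theorem m2_q0_q0 (a b c d : ℂ) : m2 a b c d q0 q0 = a := rfl

/-- Entry `⟨0|·|1⟩` of `m2`. [folklore] -/
@[simp] theorem m2_q0_q1 (a b c d : ℂ) : m2 a b c d q0 q1 = b := rfl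

/-- Entry `⟨1|·|0⟩` of `m2`. [folklore] -/
@[simp] theorem m2_q1_q0 (a b c d : ℂ) : m2 a b c d q1 q0 = c := rfl

/-- Entry `⟨1|·|1⟩` of `m2`. [folklore] -/
@[simp] theorem m2_q1_q1 (a b c d : ℂ) : m2 a b c d q1 q1 = d := rfl

/-- Every one-qubit matrix is an `m2`. [folklore] -/
theorem eq_m2 (M : Matrix (QReg 1) (QReg 1) ℂ) : M = m2 (M q0 q0) (M q0 q1) (M q1 q0) (M q1 q1) := by
  ext x y
  obtain rfl | rfl := eq_q0_or_eq_q1 x <;> obtain rfl | rfl := eq_q0_or_eq_q1 y <;> rfl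

/-- `m2` is injective. [folklore] -/
theorem m2_inj {a b c d a' b' c' d' : ℂ} :
    m2 a b c d = m2 a' b' c' d' ↔ a = a' ∧ b = b' ∧ c = c' ∧ d = d' := by
  constructor
  · intro h
    exact ⟨by simpa using congrFun (congrFun h q0) q0, by simpa using congrFun (congrFun h q0) q1,
      by simpa using congrFun (congrFun h q1) q0, by simpa using congrFun (congrFun h q1) q1⟩
  · rintro ⟨rfl, rfl, rfl, rfl⟩; rfl

/-- Matrix product by entries. [folklore] -/
theorem m2_mul_m2 (a b c d a' b' c' d' : ℂ) :
    m2 a b c d * m2 a' b' c' d' =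
      m2 (a * a' + b * c') (a * b' + b * d') (c * a' + d * c') (c * b' + d * d') := by
  ext x y
  rw [Matrix.mul_apply, sum_qReg_one]
  obtain rfl | rfl := eq_q0_or_eq_q1 x <;> obtain rfl | rfl := eq_q0_or_eq_q1 y <;> simp

/-- Sum by entries. [folklore] -/
theorem m2_add_m2 (a b c d a' b' c' d' : ℂ) :
    m2 a b c d + m2 a' b' c' d' = m2 (a + a') (b + b') (c + c') (d + d') := by
  ext x y
  obtain rfl | rfl := eq_q0_or_eq_q1 x <;> obtain rfl | rfl := eq_q0_or_eq_q1 y <;> rfl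

/-- Difference by entries. [folklore] -/
theorem m2_sub_m2 (a b c d a' b' c' d' : ℂ) :
    m2 a b c d - m2 a' b' c' d' = m2 (a - a') (b - b') (c - c') (d - d') := by
  ext x y
  obtain rfl | rfl := eq_q0_or_eq_q1 x <;> obtain rfl | rfl := eq_q0_or_eq_q1 y <;> rfl

/-- Negation by entries. [folklore] -/
theorem neg_m2 (a b c d : ℂ) : -m2 a b c d = m2 (-a) (-b) (-c) (-d) := by
  ext x y
  obtain rfl | rfl := eq_q0_or_eq_q1 x <;> obtain rfl | rfl := eq_q0_or_eq_q1 y <;> rfl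

/-- Scalar multiple by entries. [folklore] -/
theorem smul_m2 (s a b c d : ℂ) : s • m2 a b c d = m2 (s * a) (s * b) (s * c) (s * d) := by
  ext x y
  obtain rfl | rfl := eq_q0_or_eq_q1 x <;> obtain rfl | rfl := eq_q0_or_eq_q1 y <;> rfl

/-- Adjoint by entries. [folklore] -/
theorem conjTranspose_m2 (a b c d : ℂ) :
    (m2 a b c d)ᴴ = m2 (starRingEnd ℂ a) (starRingEnd ℂ c) (starRingEnd ℂ b) (starRingEnd ℂ d) := by
  ext x y
  obtain rfl | rfl := eq_q0_or_eq_q1 x <;> obtain rfl | rfl := eq_q0_or_eq_q1 y <;> rfl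

/-- `star` by entries. [folklore] -/
theorem star_m2 (a b c d : ℂ) :
    star (m2 a b c d) = m2 (starRingEnd ℂ a) (starRingEnd ℂ c) (starRingEnd ℂ b) (starRingEnd ℂ d) :=
  conjTranspose_m2 a b c d

/-- The identity by entries. [folklore] -/
theorem one_eq_m2 : (1 : Matrix (QReg 1) (QReg 1) ℂ) = m2 1 0 0 1 := by
  ext x y
  obtain rfl | rfl := eq_q0_or_eq_q1 x <;> obtain rfl | rfl := eq_q0_or_eq_q1 y <;>
    simp [q0_ne_q1, q0_ne_q1.symm]

/-- The zero matrix by entries. [folklore] -/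
theorem zero_eq_m2 : (0 : Matrix (QReg 1) (QReg 1) ℂ) = m2 0 0 0 0 := by
  ext x y
  obtain rfl | rfl := eq_q0_or_eq_q1 x <;> obtain rfl | rfl := eq_q0_or_eq_q1 y <;> rfl

/-- A scalar matrix by entries. [folklore] -/
theorem smul_one_eq_m2 (s : ℂ) : s • (1 : Matrix (QReg 1) (QReg 1) ℂ) = m2 s 0 0 s := by
  rw [one_eq_m2, smul_m2]; simp

/-- The Hadamard gate by entries, `(1/√2)·[[1, 1], [1, -1]]`. [Nielsen–Chuang 2010, §1.3.1]
[cite: NielsenChuang2010, §1.3.1] -/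
theorem hGate_eq_m2 : hGate = m2 invSqrt2 invSqrt2 invSqrt2 (-invSqrt2) := by
  ext x y
  obtain rfl | rfl := eq_q0_or_eq_q1 x <;> obtain rfl | rfl := eq_q0_or_eq_q1 y <;>
    simp [hGate, invSqrt2]

/-- The `π/8` gate by entries, `diag(1, ω)`, `ω = e^{iπ/4}`. [Nielsen–Chuang 2010, §4.2]
[cite: NielsenChuang2010, §4.2] -/
theorem tGate_eq_m2 : tGate = m2 1 0 0 omega := by
  ext x y
  obtain rfl | rfl := eq_q0_or_eq_q1 x <;> obtain rfl | rfl := eq_q0_or_eq_q1 y <;>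
    simp [tGate, q0_ne_q1, q0_ne_q1.symm]

/-! ### Unit complex numbers -/

/-- For a unit complex number, `z z̄ = 1`. [folklore] -/
theorem mul_conj_eq_one {z : ℂ} (hz : ‖z‖ = 1) : z * starRingEnd ℂ z = 1 := by
  rw [Complex.mul_conj, Complex.normSq_eq_norm_sq, hz]; simp

/-- For a unit complex number, `z̄ z = 1`. [folklore] -/
theorem conj_mul_eq_one {z : ℂ} (hz : ‖z‖ = 1) : starRingEnd ℂ z * z = 1 := by
  rw [mul_comm, mul_conj_eq_one hz]

/-- `z z̄ = 1` forces `‖z‖ = 1`. [folklore] -/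
theorem norm_eq_one_of_mul_conj {z : ℂ} (h : z * starRingEnd ℂ z = 1) : ‖z‖ = 1 := by
  rw [Complex.mul_conj, ← Complex.ofReal_one, Complex.ofReal_inj, Complex.normSq_eq_norm_sq] at h
  exact (pow_eq_one_iff_of_nonneg (norm_nonneg z) two_ne_zero).1 h

/-- A unit complex number has a unit square root. [folklore] -/
theorem exists_sq_eq_of_norm_eq_one {w : ℂ} (hw : ‖w‖ = 1) : ∃ u : ℂ, ‖u‖ = 1 ∧ u ^ 2 = w := by
  obtain ⟨u, hu⟩ := IsAlgClosed.exists_pow_nat_eq w (by norm_num : 0 < 2)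
  refine ⟨u, ?_, hu⟩
  have h : ‖u‖ ^ 2 = 1 := by rw [← norm_pow, hu, hw]
  exact (pow_eq_one_iff_of_nonneg (norm_nonneg u) two_ne_zero).1 h

/-- Polar form: `a = ‖a‖ e` with `‖e‖ = 1`. [folklore] -/
theorem exists_norm_mul_eq (a : ℂ) : ∃ e : ℂ, ‖e‖ = 1 ∧ a = (‖a‖ : ℂ) * e :=
  ⟨Complex.exp (Complex.arg a * Complex.I), Complex.norm_exp_ofReal_mul_I _,
    (Complex.norm_mul_exp_arg_mul_I a).symm⟩

/-! ### The `z`-rotations `rz u = diag(u, ū)` and scalars -/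

/-- `rz u = diag(u, ū)`; for `u = e^{-iθ/2}` this is the rotation `R_z(θ) = e^{-iθZ/2}`
(Nielsen–Chuang 2010, eq. (4.6)). [cite: NielsenChuang2010, §4.2 eq. (4.6)] -/
def rz (u : ℂ) : Matrix (QReg 1) (QReg 1) ℂ := m2 u 0 0 (starRingEnd ℂ u)

/-- `rz` is multiplicative. [folklore] -/
theorem rz_mul_rz (u v : ℂ) : rz u * rz v = rz (u * v) := by
  rw [rz, rz, rz, m2_mul_m2, map_mul, m2_inj]
  refine ⟨by ring, by ring, by ring, by ring⟩

/-- `rz 1 = 1`. [folklore] -/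
theorem rz_one : rz 1 = 1 := by rw [rz, map_one, one_eq_m2]

/-- `(rz u)† = rz ū`. [folklore] -/
theorem star_rz (u : ℂ) : star (rz u) = rz (starRingEnd ℂ u) := by
  rw [rz, rz, star_m2, map_zero, Complex.conj_conj]

/-- `rz u` is unitary for `‖u‖ = 1`. [folklore] -/
theorem rz_mem_unitaryGroup {u : ℂ} (hu : ‖u‖ = 1) : rz u ∈ Matrix.unitaryGroup (QReg 1) ℂ := by
  rw [Matrix.mem_unitaryGroup_iff, star_rz, rz_mul_rz, mul_conj_eq_one hu, rz_one]

/-- A unit scalar matrix is unitary. [folklore] -/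
theorem smul_one_mem_unitaryGroup {ι : Type*} [Fintype ι] [DecidableEq ι] {c : ℂ} (hc : ‖c‖ = 1) :
    c • (1 : Matrix ι ι ℂ) ∈ Matrix.unitaryGroup ι ℂ := by
  rw [Matrix.mem_unitaryGroup_iff, star_smul, star_one, smul_mul_smul, one_mul, Complex.star_def,
    mul_conj_eq_one hc, one_smul]

/-- **The `x`-rotations as conjugates of `z`-rotations by `H`**: `H · rz u · H =
[[ (u+ū)/2, (u-ū)/2 ], [ (u-ū)/2, (u+ū)/2 ]]` (`= cos θ·1 - i sin θ·X = R_x(2θ)` for `u = e^{-iθ}`;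
Nielsen–Chuang 2010, eq. (4.4) with Ex. 4.18 `HZH = X`). [cite: NielsenChuang2010, §4.2 eq. (4.4)] -/
theorem hGate_mul_rz_mul_hGate (u : ℂ) :
    hGate * rz u * hGate =
      m2 ((u + starRingEnd ℂ u) / 2) ((u - starRingEnd ℂ u) / 2)
        ((u - starRingEnd ℂ u) / 2) ((u + starRingEnd ℂ u) / 2) := by
  rw [hGate_eq_m2, rz, m2_mul_m2, m2_mul_m2, m2_inj]
  have h2 : invSqrt2 * invSqrt2 = 1 / 2 := invSqrt2_mul_invSqrt2
  refine ⟨?_, ?_, ?_, ?_⟩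
  · linear_combination (u + starRingEnd ℂ u) * h2
  · linear_combination (u - starRingEnd ℂ u) * h2
  · linear_combination (u - starRingEnd ℂ u) * h2
  · linear_combination (u + starRingEnd ℂ u) * h2

/-- `rz u · [[p, q], [r, t]] · rz v` by entries. [folklore] -/
theorem rz_mul_m2_mul_rz (u v p q r t : ℂ) :
    rz u * m2 p q r t * rz v =
      m2 (u * p * v) (u * q * starRingEnd ℂ v) (starRingEnd ℂ u * r * v)
        (starRingEnd ℂ u * t * starRingEnd ℂ v) := by
  rw [rz, rz, m2_mul_m2, m2_mul_m2, m2_inj]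
  refine ⟨by ring, by ring, by ring, by ring⟩

/-! ### The Euler decomposition -/

/-- **`Z`–`X`–`Z` Euler decomposition of `U(2)`.** Every one-qubit unitary is
`c • (rz u₁ · (H rz u₂ H) · rz u₃)` — a global phase times a `z`-rotation, an `x`-rotation and a
`z`-rotation — with unit complex parameters `c, u₁, u₂, u₃` (Nielsen–Chuang 2010, Thm. 4.1 and
eqs. (4.11)–(4.12), there in the `Z`–`Y` form; Boykin et al. 1999, eq. (euler0)/(euler): Euler
decomposition about two orthogonal axes). Proof: write `V = [[a, b], [c, d]]`; unitarity gives
`a ā + b b̄ = 1`, `c ā + d b̄ = 0`, whence `d = δ ā`, `c = -δ b̄`, `δ δ̄ = 1` for `δ = ad - bc`;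
with `a = ‖a‖ eₐ`, `b = ‖b‖ e_b` one takes `u₂ = ‖a‖ + i‖b‖`, `c² = δ`,
`u₁² = eₐ e_b δ̄ (-i)`, `u₃ = eₐ c̄ ū₁` and checks the four entries.
[cite: NielsenChuang2010, §4.2 Thm. 4.1] -/
theorem exists_euler {V : Matrix (QReg 1) (QReg 1) ℂ} (hV : V ∈ Matrix.unitaryGroup (QReg 1) ℂ) :
    ∃ c u₁ u₂ u₃ : ℂ, ‖c‖ = 1 ∧ ‖u₁‖ = 1 ∧ ‖u₂‖ = 1 ∧ ‖u₃‖ = 1 ∧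
      V = c • (rz u₁ * (hGate * rz u₂ * hGate) * rz u₃) := by
  -- entries and the unitarity relations
  have hVm : V = m2 (V q0 q0) (V q0 q1) (V q1 q0) (V q1 q1) := eq_m2 V
  set a := V q0 q0 with ha_def
  set b := V q0 q1 with hb_def
  set c := V q1 q0 with hc_def
  set d := V q1 q1 with hd_def
  have h1 := Matrix.mem_unitaryGroup_iff.1 hV
  rw [hVm, star_m2, m2_mul_m2, one_eq_m2, m2_inj] at h1
  obtain ⟨h11, -, h21, h22⟩ := h1
  -- `d = δ ā`, `c = -δ b̄`, `δ δ̄ = 1`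
  set δ := a * d - b * c with hδ_def
  have hd : d = δ * starRingEnd ℂ a := by linear_combination (-d) * h11 + b * h21
  have hc : c = -(δ * starRingEnd ℂ b) := by linear_combination (-c) * h11 + a * h21
  have hd' : starRingEnd ℂ d = starRingEnd ℂ δ * a := by
    rw [hd, map_mul, Complex.conj_conj]
  have hc' : starRingEnd ℂ c = -(starRingEnd ℂ δ * b) := by
    rw [hc, map_neg, map_mul, Complex.conj_conj]
  have hδ : δ * starRingEnd ℂ δ = 1 := by
    linear_combination (-(δ * starRingEnd ℂ δ)) * h11 - c * hc' + (starRingEnd ℂ δ * b) * hc -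
      d * hd' - (starRingEnd ℂ δ * a) * hd + h22
  have hδ1 : ‖δ‖ = 1 := norm_eq_one_of_mul_conj hδ
  -- polar forms of `a` and `b`, and `‖a‖² + ‖b‖² = 1`
  obtain ⟨ea, hea1, hea⟩ := exists_norm_mul_eq a
  obtain ⟨eb, heb1, heb⟩ := exists_norm_mul_eq b
  have hab : ((‖a‖ : ℂ)) ^ 2 + ((‖b‖ : ℂ)) ^ 2 = 1 := by
    have ha2 : a * starRingEnd ℂ a = ((‖a‖ : ℂ)) ^ 2 := by
      rw [Complex.mul_conj, Complex.normSq_eq_norm_sq]; push_cast; ring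
    have hb2 : b * starRingEnd ℂ b = ((‖b‖ : ℂ)) ^ 2 := by
      rw [Complex.mul_conj, Complex.normSq_eq_norm_sq]; push_cast; ring
    rw [← ha2, ← hb2, h11]
  -- the parameters
  obtain ⟨sq, hsq1, hsq⟩ := exists_sq_eq_of_norm_eq_one hδ1
  set u₂ : ℂ := (‖a‖ : ℂ) + (‖b‖ : ℂ) * Complex.I with hu₂_def
  have hu₂conj : starRingEnd ℂ u₂ = (‖a‖ : ℂ) - (‖b‖ : ℂ) * Complex.I := by
    rw [hu₂_def, map_add, map_mul, Complex.conj_ofReal, Complex.conj_ofReal, Complex.conj_I]; ring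
  have hu₂1 : ‖u₂‖ = 1 := by
    apply norm_eq_one_of_mul_conj
    rw [hu₂conj, hu₂_def]
    linear_combination (norm := ring_nf) hab
    rw [Complex.I_sq]; ring
  have hw1 : ‖ea * eb * starRingEnd ℂ δ * (-Complex.I)‖ = 1 := by
    simp [hea1, heb1, hδ1]
  obtain ⟨u₁, hu₁1, hu₁⟩ := exists_sq_eq_of_norm_eq_one hw1
  set u₃ : ℂ := ea * starRingEnd ℂ sq * starRingEnd ℂ u₁ with hu₃_def
  have hu₃1 : ‖u₃‖ = 1 := by
    simp [hu₃_def, hea1, hsq1, hu₁1]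
  -- unit relations
  have rea := mul_conj_eq_one hea1
  have reb := mul_conj_eq_one heb1
  have rsq := mul_conj_eq_one hsq1
  have ru₁ := mul_conj_eq_one hu₁1
  have hu₁' : (starRingEnd ℂ u₁) ^ 2 = starRingEnd ℂ ea * starRingEnd ℂ eb * δ * Complex.I := by
    rw [← map_pow, hu₁]; simp [map_mul, Complex.conj_I]
  have hu₃conj : starRingEnd ℂ u₃ = starRingEnd ℂ ea * sq * u₁ := by
    rw [hu₃_def, map_mul, map_mul, Complex.conj_conj, Complex.conj_conj]
  refine ⟨sq, u₁, u₂, u₃, hsq1, hu₁1, hu₂1, hu₃1, ?_⟩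
  rw [hGate_mul_rz_mul_hGate, rz_mul_m2_mul_rz, smul_m2, hVm, m2_inj, hu₂conj, hu₂_def, hu₃conj,
    hu₃_def]
  refine ⟨?_, ?_, ?_, ?_⟩
  · -- `a = c u₁ ‖a‖ u₃`
    calc a = (‖a‖ : ℂ) * ea := hea
      _ = (‖a‖ : ℂ) * ea * (sq * starRingEnd ℂ sq) * (u₁ * starRingEnd ℂ u₁) := by
          rw [rsq, ru₁]; ring
      _ = _ := by ring
  · -- `b = c u₁ (i‖b‖) ū₃`
    calc b = (‖b‖ : ℂ) * eb := heb
      _ = (δ * starRingEnd ℂ δ) * (ea * starRingEnd ℂ ea) * (-(Complex.I * Complex.I)) *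
          ((‖b‖ : ℂ) * eb) := by rw [hδ, rea, Complex.I_mul_I]; ring
      _ = sq ^ 2 * u₁ ^ 2 * ((‖b‖ : ℂ) * Complex.I) * starRingEnd ℂ ea := by
          rw [hsq, hu₁]; ring
      _ = _ := by ring
  · -- `c = c ū₁ (i‖b‖) u₃`
    calc c = -(δ * ((‖b‖ : ℂ) * starRingEnd ℂ eb)) := by
          conv_lhs => rw [hc, heb]
          rw [map_mul, Complex.conj_ofReal]
      _ = (sq * starRingEnd ℂ sq) * (ea * starRingEnd ℂ ea) * (Complex.I * Complex.I) * δ *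
            ((‖b‖ : ℂ) * starRingEnd ℂ eb) := by rw [rsq, rea, Complex.I_mul_I]; ring
      _ = sq * (starRingEnd ℂ u₁) ^ 2 * ((‖b‖ : ℂ) * Complex.I) * ea * starRingEnd ℂ sq := by
          rw [hu₁']; ring
      _ = _ := by ring
  · -- `d = c ū₁ ‖a‖ ū₃`
    calc d = δ * ((‖a‖ : ℂ) * starRingEnd ℂ ea) := by
          conv_lhs => rw [hd, hea]
          rw [map_mul, Complex.conj_ofReal]
      _ = sq ^ 2 * (u₁ * starRingEnd ℂ u₁) * ((‖a‖ : ℂ) * starRingEnd ℂ ea) := by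
          rw [hsq, ru₁]; ring
      _ = _ := by ring

/-! ### Packaging in the unitary group, and the generation corollary -/

/-- `rz u` as an element of `U(2)` (`‖u‖ = 1`). [folklore] -/
def rzU (u : ℂ) (hu : ‖u‖ = 1) : Matrix.unitaryGroup (QReg 1) ℂ := ⟨rz u, rz_mem_unitaryGroup hu⟩

/-- The Hadamard gate as an element of `U(2)`. [folklore] -/
def hU : Matrix.unitaryGroup (QReg 1) ℂ := ⟨hGate, hGate_mem_unitaryGroup_holds⟩

/-- The phase `c • 1` as an element of `U(2)` (`‖c‖ = 1`). [folklore] -/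
def phaseU (c : ℂ) (hc : ‖c‖ = 1) : Matrix.unitaryGroup (QReg 1) ℂ :=
  ⟨c • 1, smul_one_mem_unitaryGroup hc⟩

/-- Matrix of `rzU`. [folklore] -/
@[simp] theorem coe_rzU (u : ℂ) (hu : ‖u‖ = 1) :
    ((rzU u hu : Matrix.unitaryGroup (QReg 1) ℂ) : Matrix (QReg 1) (QReg 1) ℂ) = rz u := rfl

/-- Matrix of `hU`. [folklore] -/
@[simp] theorem coe_hU : ((hU : Matrix.unitaryGroup (QReg 1) ℂ) : Matrix (QReg 1) (QReg 1) ℂ) = hGate := rfl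

/-- Matrix of `phaseU`. [folklore] -/
@[simp] theorem coe_phaseU (c : ℂ) (hc : ‖c‖ = 1) :
    ((phaseU c hc : Matrix.unitaryGroup (QReg 1) ℂ) : Matrix (QReg 1) (QReg 1) ℂ) = c • 1 := rfl

/-- Phases are central in `U(2)`. [folklore] -/
theorem phaseU_comm (c : ℂ) (hc : ‖c‖ = 1) (X : Matrix.unitaryGroup (QReg 1) ℂ) :
    X * phaseU c hc = phaseU c hc * X :=
  Subtype.ext (by simp)

/-- **Generation corollary of the Euler decomposition.** Let `M` be a subgroup of `U(2)`
containing the phases and, for a fixed `W ∈ U(2)`, the conjugates `W (rz u) W⁻¹` and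
`W (H rz u H) W⁻¹` of all `z`- and `x`-rotations (i.e. the two one-parameter groups of rotations
about the orthogonal axes `W ẑ`, `W x̂`). Then `M = U(2)`: for `V ∈ U(2)` decompose
`W⁻¹ V W = c • rz u₁ (H rz u₂ H) rz u₃` and conjugate back (Boykin et al. 1999, §3, eq. (euler):
"since `n̂₁` and `n̂₂` are orthogonal, we can write any element of `SU(2)` in the following
form"). [cite: BoykinEtAl1999, §3 eq. (euler)] -/
theorem subgroup_eq_top_of_conj_rz_mem (M : Subgroup (Matrix.unitaryGroup (QReg 1) ℂ))
    (W : Matrix.unitaryGroup (QReg 1) ℂ)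
    (hz : ∀ (u : ℂ) (hu : ‖u‖ = 1), W * rzU u hu * W⁻¹ ∈ M)
    (hx : ∀ (u : ℂ) (hu : ‖u‖ = 1), W * (hU * rzU u hu * hU) * W⁻¹ ∈ M)
    (hph : ∀ (c : ℂ) (hc : ‖c‖ = 1), phaseU c hc ∈ M) : M = ⊤ := by
  rw [eq_top_iff]
  intro V _
  obtain ⟨c, u₁, u₂, u₃, hc, hu₁, hu₂, hu₃, hV⟩ := exists_euler (W⁻¹ * V * W).2
  have key : W⁻¹ * V * W =
      phaseU c hc * (rzU u₁ hu₁ * (hU * rzU u₂ hu₂ * hU) * rzU u₃ hu₃) := by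
    apply Subtype.ext
    rw [hV]
    simp
  have hVeq : V = W * (W⁻¹ * V * W) * W⁻¹ := by group
  have hconj : W * (phaseU c hc * (rzU u₁ hu₁ * (hU * rzU u₂ hu₂ * hU) * rzU u₃ hu₃)) * W⁻¹ =
      phaseU c hc * ((W * rzU u₁ hu₁ * W⁻¹) * (W * (hU * rzU u₂ hu₂ * hU) * W⁻¹) *
        (W * rzU u₃ hu₃ * W⁻¹)) := by
    rw [← mul_assoc W, phaseU_comm c hc W]
    group
  rw [hVeq, key, hconj]
  exact M.mul_mem (hph c hc) (M.mul_mem (M.mul_mem (hz u₁ hu₁) (hx u₂ hu₂)) (hz u₃ hu₃))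

end Literature.Computability.QuantumComplexity.OneQubit
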